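import Summits.BirchSwinnertonDyer.Rank1Residual.X9.PrintCertImage
import Literature.NumberTheory.EllipticCurves.ModThreeImageCubeDiscriminantProofs
import Literature.NumberTheory.EllipticCurves.ModFiveImageSplitCartanJLineProofs
import Literature.NumberTheory.EllipticCurves.ModFiveImageS4JLineProofs
import Literature.NumberTheory.EllipticCurves.ModSevenImageSplitCartanJLineProofs
import HarnessLib

/-!
# Leaves X9 / X10b — per-pair certificate records: `¬Surj` IN THE KERNEL, the `j`-line theorems at
# `3` and `5` DISCHARGED (companion of `X9/PrintCertImage.lean`)

HONEST FRAMING (cell `bsd-print-x9`, D-0131 (2) print tier; partition leaves `ClassX9` and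
`ClassX10 ∧ ¬Surj`; seat `bsd-print-x9-p1`, strategy «discharge image certificates per class»):
theorems only; no named fact introduced; no leaf claimed closed. `X9/PrintCertImage.lean` turns a
record's image certificate `j(W) = J_G(u/v)` into `¬Surj W p` MODULO Zywina's five `j`-line facts
`h3s h3n h5s h5e h7` taken as hypotheses. Four of the five are now THEOREMS of the tree:
`zywina2015_thm12_not_surjective_three_of_j_eq_J2/J4_holds` (`ModThreeImageCubeDiscriminantProofs`, ARM P)
and `zywina2015_thm14_not_surjective_five_of_j_eq_J4/J9_holds` (`ModFiveImageSplitCartanJLineProofs`,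
`ModFiveImageS4JLineProofs`: the division-polynomial criterion along `X_{N_s(5)}` and the cubic-field
criterion for `G₉ ⊃ N_s(5)`, this seat). Hence:
* `not_surj_of_check_of_seven` — `¬Surj W p` for every certified record modulo the single remaining
  fact `h7` (Zywina Thm. 1.5, `N_s(7)`; only the `7Ns` records use it);
* `not_surj_of_check_of_p_ne_seven` — `¬Surj W p` with NO named-fact hypothesis for every certified
  record with `p ≠ 7` (all `3Ns`/`3Nn`/`5Ns`/`5S4` records, i.e. every X10b record and every X9 record
  at `p = 5`);
* `classX9_five_of_check`, `classX10b_of_check_kernel` — the leaf predicates with ONE remaining claim,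
  the analytic rank, and no named fact; `classX9_of_check_of_seven` for the `p = 7` records.
References: [Zywina2015] Thm. 1.2, 1.4, 1.5; [Serre1972] §2; [SilvermanAEC2009] III.1, Ex. 3.7.
-/

set_option autoImplicit false

noncomputable section

open scoped Classical

open WeierstrassCurve Literature.NumberTheory.EllipticCurves Literature.NumberTheory.EllipticCurves.Rank1Residual
  Literature.NumberTheory.EllipticCurves.Rank1Residual.X11RankOneCertificates
  Summit.BirchSwinnertonDyer.BirchSwinnertonDyer.Rank1Residual.IntModel

namespace Summit.BirchSwinnertonDyer.Rank1Residual.X9.PrintCert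

namespace Record

variable (r : Record)

section Image

variable {W : WeierstrassCurve ℚ} [W.IsElliptic] [W.IsGloballyMinimal] (hI : integralModelInt W = r.intCurve)
include hI

/-- **`¬Surj W p` from the image certificate, modulo Zywina Thm. 1.5 (`N_s(7)`) alone**: the `j`-line
facts at `3` (ARM P, `…three_of_j_eq_J2/J4_holds`) and at `5` (`…five_of_j_eq_J4/J9_holds`, division
polynomials) are theorems. [cite: Zywina2015, Thm. 1.2, 1.4, 1.5 (second items)] -/
theorem not_surj_of_check_of_seven (hc : r.check = true) (hsome : r.imageCert.isSome = true)
    (h7 : zywina2015_thm15_not_surjective_seven_of_j_eq_J2) {q : ℕ} [Fact q.Prime] (hq : q = r.p) :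
    ¬ Surj W q :=
  r.not_surj_of_check hI hc hsome zywina2015_thm12_not_surjective_three_of_j_eq_J2_holds
    zywina2015_thm12_not_surjective_three_of_j_eq_J4_holds
    zywina2015_thm14_not_surjective_five_of_j_eq_J4_holds
    zywina2015_thm14_not_surjective_five_of_j_eq_J9_holds h7 hq

/-- **`¬Surj W p` IN THE KERNEL for every certified record with `p ≠ 7`** (image types `3Ns`, `3Nn`,
`5Ns`, `5S4`): the argument of `Record.not_surj_of_check` with the four `j`-line facts at `3` and `5`
supplied by their tree theorems; the `7Ns` branch is excluded by `p ≠ 7`.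
[cite: Zywina2015, Thm. 1.2 (second item, i = 2, 4), Thm. 1.4 (second item, i = 4, 9)] -/
theorem not_surj_of_check_of_p_ne_seven (hc : r.check = true) (hsome : r.imageCert.isSome = true)
    (hp7 : r.p ≠ 7) {q : ℕ} [Fact q.Prime] (hq : q = r.p) : ¬ Surj W q := by
  obtain ⟨⟨u, v⟩, huv⟩ := Option.isSome_iff_exists.mp hsome
  obtain ⟨hj, hv, hden⟩ := r.j_mul_jMapDen_eq_of_check hI hc huv
  have hCM := r.not_hasCM_of_check hI hc
  have hp := r.p_eq_prime_of_check hc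
  subst hq
  show ¬ W.HasSurjectiveModNGaloisRep (r.p : ℤ)
  rw [hp] at hp7 ⊢
  have hvq : (v : ℚ) ≠ 0 := by exact_mod_cast hv
  have hdenq : (jMapDen r.imageType u v : ℚ) ≠ 0 := by exact_mod_cast hden
  obtain ⟨t, ht⟩ : ∃ t : ℚ, (u : ℚ) = t * v := ⟨u / v, by rw [div_mul_cancel₀ _ hvq]⟩
  cases hT : r.imageType <;>
    simp only [hT, jMapNum, jMapDen, ImageType.prime, ne_eq, Int.cast_mul, Int.cast_pow, Int.cast_add,
      Int.cast_sub, Int.cast_ofNat, mul_eq_zero, not_or] at hj hdenq hp7 ⊢ <;> rw [ht] at hj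
  · -- `3Ns`: `J₂` at `3`; `t ≠ 0` since `u ≠ 0`
    refine zywina2015_thm12_not_surjective_three_of_j_eq_J2_holds W hCM t ?_
      (mul_left_cancel₀ (pow_ne_zero 6 hvq) (by linear_combination hj))
    rintro rfl
    exact hdenq.1 (by rw [ht]; ring)
  · -- `3Nn`: `J₄(t) = t³` at `3`
    exact zywina2015_thm12_not_surjective_three_of_j_eq_J4_holds W hCM t
      (mul_left_cancel₀ (pow_ne_zero 3 hvq) (by linear_combination hj))
  · -- `5Ns`: `J₄` at `5`; `t² + 5t + 5 ≠ 0` since `u² + 5uv + 5v² ≠ 0`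
    refine zywina2015_thm14_not_surjective_five_of_j_eq_J4_holds W hCM t ?_
      (mul_left_cancel₀ (pow_ne_zero 15 hvq) (by linear_combination hj))
    intro h0
    exact hdenq.1 (by rw [ht]; linear_combination (v : ℚ) ^ 10 * (t ^ 2 + 5 * t + 5) ^ 4 * h0)
  · -- `5S4`: `J₉(t) = t³(t² + 5t + 40)` at `5`
    exact zywina2015_thm14_not_surjective_five_of_j_eq_J9_holds W hCM t
      (mul_left_cancel₀ (pow_ne_zero 5 hvq) (by linear_combination hj))
  · -- `7Ns`: excluded
    exact (hp7 trivial).elim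

/-- **The leaf predicate X9 at `p = 5` with ONE remaining claim and NO named fact**: `¬CM ∧ GoodOrd ∧ Irr`
from the recheck, `¬Surj` from the image certificate IN THE KERNEL, the analytic rank `hrank` the
record's CLAIM. [cite: Zywina2015, Thm. 1.4 (second items, i = 4, 9)] -/
theorem classX9_five_of_check (hc : r.check = true) (hsome : r.imageCert.isSome = true) (hp5 : r.p = 5)
    {q : ℕ} [Fact q.Prime] (hq : q = r.p) (hrank : W.analyticRank = r.rank) : ClassX9 W q :=
  r.classX9_of_check hI hc hq (by omega)
    (r.not_surj_of_check_of_p_ne_seven hI hc hsome (by omega) hq) hrank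

/-- **The leaf predicate X9 with ONE remaining claim, modulo Zywina Thm. 1.5 (`N_s(7)`) only** (all
`p ≥ 5` records; the fact is used only on the `7Ns` ones). [cite: Zywina2015, Thm. 1.4, 1.5 (second items)] -/
theorem classX9_of_check_of_seven (hc : r.check = true) (hsome : r.imageCert.isSome = true)
    (h7 : zywina2015_thm15_not_surjective_seven_of_j_eq_J2) {q : ℕ} [Fact q.Prime] (hq : q = r.p)
    (hp5 : 5 ≤ q) (hrank : W.analyticRank = r.rank) : ClassX9 W q :=
  r.classX9_of_check hI hc hq hp5 (r.not_surj_of_check_of_seven hI hc hsome h7 hq) hrank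

/-- **The leaf predicate X10b with ONE remaining claim and NO named fact** (`p = 3`): `ClassX10 W 3 ∧
¬Surj W 3` from the recheck, the image certificate IN THE KERNEL (Zywina Thm. 1.2 at `3` is a tree
theorem), and the analytic-rank CLAIM `hrank`. [cite: Zywina2015, Thm. 1.2 (second items, i = 2, 4)] -/
theorem classX10b_of_check_kernel (hc : r.check = true) (hsome : r.imageCert.isSome = true)
    (hp3 : r.p = 3) (hrank : W.analyticRank = r.rank) : ClassX10 W 3 ∧ ¬ Surj W 3 :=
  ⟨r.classX10_of_check hI hc hp3 hp3.symm hrank,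
    r.not_surj_of_check_of_p_ne_seven hI hc hsome (by omega) hp3.symm⟩

/-! ### All five `j`-line facts are theorems: the image certificate is KERNEL for every record -/

/-- **`¬Surj W p` IN THE KERNEL for EVERY certified record** (image types `3Ns`, `3Nn`, `5Ns`, `5S4`,
`7Ns`): `Record.not_surj_of_check` with all five of Zywina's `j`-line facts supplied by tree theorems
(`…three_of_j_eq_J2/J4_holds`, `…five_of_j_eq_J4/J9_holds`, `…seven_of_j_eq_J2_holds`) — no named-fact
hypothesis remains. [cite: Zywina2015, Thm. 1.2, 1.4, 1.5 (second items)] -/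
theorem not_surj_of_check_kernel (hc : r.check = true) (hsome : r.imageCert.isSome = true) {q : ℕ}
    [Fact q.Prime] (hq : q = r.p) : ¬ Surj W q :=
  r.not_surj_of_check_of_seven hI hc hsome zywina2015_thm15_not_surjective_seven_of_j_eq_J2_holds hq

/-- **The leaf predicate X9 with ONE remaining claim and NO named fact** (every `p ≥ 5` record):
`¬CM ∧ GoodOrd ∧ Irr ∧ ¬Surj` IN THE KERNEL from the recheck and the image certificate; the analytic rank
`hrank` is the record's only CLAIM. [cite: Zywina2015, Thm. 1.4, 1.5 (second items)] -/
theorem classX9_of_check_kernel (hc : r.check = true) (hsome : r.imageCert.isSome = true) {q : ℕ}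
    [Fact q.Prime] (hq : q = r.p) (hp5 : 5 ≤ q) (hrank : W.analyticRank = r.rank) : ClassX9 W q :=
  r.classX9_of_check hI hc hq hp5 (r.not_surj_of_check_kernel hI hc hsome hq) hrank

end Image

end Record

end Summit.BirchSwinnertonDyer.Rank1Residual.X9.PrintCert

end
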